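import Literature.AlgebraicGeometry.ShimuraVarieties.UnitaryBallAutomorphicForms
import Literature.Geometry.ComplexHyperbolic.UnitBallBounds
import Literature.NumberTheory.Automorphic.UnitaryGroupArchimedean

/-!
# Arithmetic subgroups of `U(2,1)` act properly discontinuously and freely on the ball

For a unitary ball-quotient datum `D : UnitaryBallUniformisationDatum 2 X` (CM field `E ⊆ ℂ`, hermitian
`H` of signature `(2,1)` at `τ₁` and definite at the other places, torsion-free congruence subgroup
`Γ ≤ U(H)(E)`) and a Sylvester frame `𝔣` (so `D.ballRep 𝔣 : Γ →* U(2,1)` and `Γ` acts on `𝔹²`), we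
PROVE:

* `finite_setOf_norm_entry_le` — **discreteness**: only finitely many `γ ∈ Γ` have all entries of
  `ballRep γ` of norm `≤ R`. Proof: the entries of `γ ∈ Γ(𝔫) ⊆ 1 + 𝔫·M₃(𝓞_E)` are algebraic integers
  (`isIntegral_apply`); at `τ₁` they are bounded in terms of `ballRep γ = T⁻¹ γ^{τ₁} T`
  (`norm_τ₁_apply_le`), at the conjugate embedding by the same bound, and at every other embedding
  `τ` by a constant, `U(H^τ)` being the unitary group of a DEFINITE form
  (`Literature.NumberTheory.Automorphic.Matrix.exists_norm_entry_le_of_posDef`); so they range in a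
  finite set (`NumberField.Embeddings.finite_of_norm_le`), and `Γ(𝔫)` has finite index in `Γ`;
* `finite_setOf_smul_mem` — **proper discontinuity**: for compact `K, L ⊆ 𝔹²` the set
  `{γ | γK ∩ L ≠ ∅}` is finite (the entries of such `γ` are bounded,
  `BallModel.exists_norm_entry_le_of_isCompact`);
* `eq_one_of_smul_eq` — **freeness**: `γ z = z ⇒ γ = 1` (stabilisers are finite, hence torsion, and
  `Γ` is torsion free);
* `exists_isOpen_forall_smul_mem_imp` — every `z ∈ 𝔹²` has an open neighbourhood `U` with
  `γ U ∩ U = ∅` for all `γ ≠ 1`; consequently the uniformization `ballUnifMap : 𝔹² → X(ℂ)`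
  (whose fibres are the `Γ`-orbits) is **injective on `U`** (`exists_isOpen_injOn_ballUnifMap`).

These are the standard facts "an arithmetic subgroup is discrete" and "a discrete torsion-free
subgroup of `G` acts freely and properly discontinuously on `G/K`", specialised to `U(2,1)` and the
ball, with elementary proofs (no Lie theory).

References: A. Borel, *Introduction aux groupes arithmétiques* (Hermann 1969), §1 and Prop. 7.13
(arithmetic groups are discrete; `G_ℤ` acts properly on `X = G_ℝ/K`); N. Bergeron, J. Millson,
C. Moeglin, *Hodge type theorems for arithmetic manifolds associated to orthogonal groups* /
*The Hodge conjecture and arithmetic quotients of complex balls*, Acta Math. 216 (2016),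
Introduction §1.1 (`S(Γ) = Γ\X` for torsion-free congruence `Γ`).

## Provenance

Written under the LEAN-IN-TREE rule for the pub-hodgecm formalisation cell (model-construction
sub-cell, seat mc-autform-1 gen 2, MODEL-DAG node D1-G-iii-c). It is the first step of the DESCENT of
holomorphic automorphic forms on `𝔹²` to holomorphic forms on `X^an` (local injectivity of the
uniformization). Nothing in this file is a claim of the manuscripts adjudicated by that cell.
-/

set_option autoImplicit false

noncomputable section

open Matrix Complex ComplexConjugate NumberField
open Literature.Geometry.ComplexHyperbolic
open Literature.Geometry.ComplexHyperbolic.BallModel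

namespace Literature.AlgebraicGeometry.ShimuraVarieties

namespace UnitaryBallUniformisationDatum

open Literature.AlgebraicGeometry.Motives (SchemeOver)

/-! ### Entries of `Γ` at the complex embeddings of `E` (any `p`) -/

section Embeddings

variable {p : ℕ} {X : SchemeOver ℂ} (D : UnitaryBallUniformisationDatum p X)

/-- An isometry of `(V, H)` is unitary for `H^τ` at EVERY complex embedding `τ`:
`(γ^τ)ᴴ H^τ γ^τ = H^τ` (apply `τ` to `(σγ)ᵀ H γ = H`; `τ ∘ σ = conj ∘ τ`).
[cite: BergeronMillsonMoeglin2016Balls, Part 2 §1.2] -/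
theorem conjTranspose_map_mul_map (τ : D.E →+* ℂ) {γ : GL (Fin (p + 1)) D.E}
    (hγ : γ ∈ unitaryGroup (conjRingHom D.E) D.H) :
    ((γ : Matrix (Fin (p + 1)) (Fin (p + 1)) D.E).map τ)ᴴ * D.H.map τ *
      (γ : Matrix (Fin (p + 1)) (Fin (p + 1)) D.E).map τ = D.H.map τ := by
  have h := congrArg (fun M : Matrix (Fin (p + 1)) (Fin (p + 1)) D.E ↦ M.map τ)
    (mem_unitaryGroup_iff.1 hγ)
  simp only [Matrix.map_mul] at h
  have ht : (((γ : Matrix (Fin (p + 1)) (Fin (p + 1)) D.E).map (conjRingHom D.E))ᵀ).map τ =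
      ((γ : Matrix (Fin (p + 1)) (Fin (p + 1)) D.E).map τ)ᴴ := by
    ext i j
    simp only [Matrix.map_apply, transpose_apply, conjTranspose_apply, Complex.star_def,
      embedding_conjRingHom]
  rwa [ht] at h

/-- **Bounded at the definite places**: at a complex embedding `τ` not defining the place of `τ₁`,
the entries `τ(γᵢⱼ)`, `γ ∈ Γ`, are bounded by a constant (`U(H^τ)` is the unitary group of a positive
definite form, hence bounded). [cite: PlatonovRapinchuk1994, §3.2 Thm 3.1] -/
theorem exists_norm_embedding_apply_le (τ : D.E →+* ℂ)
    (hτ : InfinitePlace.mk τ ≠ InfinitePlace.mk D.τ₁) :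
    ∃ C : ℝ, ∀ γ : D.Γ, ∀ i j,
      ‖τ (((γ : GL (Fin (p + 1)) D.E) : Matrix (Fin (p + 1)) (Fin (p + 1)) D.E) i j)‖ ≤ C := by
  obtain ⟨C, hC⟩ :=
    Literature.NumberTheory.Automorphic.Matrix.exists_norm_entry_le_of_posDef (D.posDef_of_ne τ hτ)
  refine ⟨C, fun γ i j ↦ ?_⟩
  have h := hC _ (D.conjTranspose_map_mul_map τ (D.isCongruenceSubgroup.1 γ.2)) i j
  rwa [Matrix.map_apply] at h

/-- **Integrality on `Γ(𝔫)`**: the entries of an element of the principal congruence subgroup are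
algebraic integers (`γ = 1 + 𝔫 A`, `A ∈ M(𝓞_E)`). [folklore] -/
theorem isIntegral_apply {n : ℕ} {γ : GL (Fin (p + 1)) D.E}
    (hγ : γ ∈ principalCongruenceSubgroup (conjRingHom D.E) D.H n) (i j : Fin (p + 1)) :
    IsIntegral ℤ ((γ : Matrix (Fin (p + 1)) (Fin (p + 1)) D.E) i j) := by
  obtain ⟨A, hA⟩ := hγ.2.1
  have hmap : (γ : Matrix (Fin (p + 1)) (Fin (p + 1)) D.E) =
      (1 + n • A).map (algebraMap (𝓞 D.E) D.E) := by
    rw [hA]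
    change _ = (algebraMap (𝓞 D.E) D.E).mapMatrix (1 + n • A)
    rw [map_add, map_one, map_nsmul]
    rfl
  rw [hmap, Matrix.map_apply]
  exact RingOfIntegers.isIntegral_coe _

/-- At the conjugate embedding the entries have the same norms as at `τ₁`. [folklore] -/
theorem norm_embedding_eq_of_mk_eq {τ : D.E →+* ℂ}
    (hτ : InfinitePlace.mk τ = InfinitePlace.mk D.τ₁) (x : D.E) : ‖τ x‖ = ‖D.τ₁ x‖ := by
  rcases InfinitePlace.mk_eq_iff.1 hτ with h | h
  · rw [h]
  · rw [← h, ComplexEmbedding.conjugate_coe_eq, Complex.norm_conj]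

end Embeddings

/-! ### Discreteness of `Γ` in `U(2,1)` -/

variable {X₂ : SchemeOver ℂ} (D : UnitaryBallUniformisationDatum 2 X₂) (𝔣 : D.SylvesterFrame)

/-- `γ^{τ₁} = T · ballRep γ · T⁻¹`. [folklore] -/
theorem map_τ₁_eq (γ : D.Γ) :
    ((γ : GL (Fin 3) D.E) : Matrix (Fin 3) (Fin 3) D.E).map D.τ₁ =
      𝔣.t * mat (D.ballRep 𝔣 γ) * 𝔣.ti := by
  rw [mat_ballRep]
  calc ((γ : GL (Fin 3) D.E) : Matrix (Fin 3) (Fin 3) D.E).map D.τ₁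
        = (𝔣.t * 𝔣.ti) * ((γ : GL (Fin 3) D.E) : Matrix (Fin 3) (Fin 3) D.E).map D.τ₁ *
            (𝔣.t * 𝔣.ti) := by rw [𝔣.t_mul_ti, Matrix.one_mul, Matrix.mul_one]
    _ = 𝔣.t * (𝔣.ti * ((γ : GL (Fin 3) D.E) : Matrix (Fin 3) (Fin 3) D.E).map D.τ₁ * 𝔣.t) *
          𝔣.ti := by simp only [Matrix.mul_assoc]

namespace SylvesterFrame

variable {D}

/-- A bound for the entries of the frame matrix `T`. [folklore] -/
def tBound : ℝ := ∑ i, ∑ j, ‖𝔣.t i j‖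

/-- A bound for the entries of `T⁻¹`. [folklore] -/
def tiBound : ℝ := ∑ i, ∑ j, ‖𝔣.ti i j‖

/-- `‖T i j‖ ≤ tBound`. [folklore] -/
theorem norm_t_le (i j : Fin 3) : ‖𝔣.t i j‖ ≤ 𝔣.tBound := by
  unfold tBound
  calc ‖𝔣.t i j‖ ≤ ∑ j', ‖𝔣.t i j'‖ :=
        Finset.single_le_sum (f := fun j' ↦ ‖𝔣.t i j'‖) (fun _ _ ↦ norm_nonneg _)
          (Finset.mem_univ j)
    _ ≤ ∑ i', ∑ j', ‖𝔣.t i' j'‖ :=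
        Finset.single_le_sum (f := fun i' ↦ ∑ j', ‖𝔣.t i' j'‖)
          (fun _ _ ↦ Finset.sum_nonneg fun _ _ ↦ norm_nonneg _) (Finset.mem_univ i)

/-- `‖T⁻¹ i j‖ ≤ tiBound`. [folklore] -/
theorem norm_ti_le (i j : Fin 3) : ‖𝔣.ti i j‖ ≤ 𝔣.tiBound := by
  unfold tiBound
  calc ‖𝔣.ti i j‖ ≤ ∑ j', ‖𝔣.ti i j'‖ :=
        Finset.single_le_sum (f := fun j' ↦ ‖𝔣.ti i j'‖) (fun _ _ ↦ norm_nonneg _)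
          (Finset.mem_univ j)
    _ ≤ ∑ i', ∑ j', ‖𝔣.ti i' j'‖ :=
        Finset.single_le_sum (f := fun i' ↦ ∑ j', ‖𝔣.ti i' j'‖)
          (fun _ _ ↦ Finset.sum_nonneg fun _ _ ↦ norm_nonneg _) (Finset.mem_univ i)

end SylvesterFrame

/-- **Bounded at `τ₁` in terms of `ballRep`**: if the entries of `ballRep γ` have norm `≤ R` then
`‖τ₁(γᵢⱼ)‖ ≤ 9 · tBound · R · tiBound`. [folklore] -/
theorem norm_τ₁_apply_le {γ : D.Γ} {R : ℝ} (h : ∀ i j, ‖mat (D.ballRep 𝔣 γ) i j‖ ≤ R)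
    (i j : Fin 3) :
    ‖D.τ₁ (((γ : GL (Fin 3) D.E) : Matrix (Fin 3) (Fin 3) D.E) i j)‖ ≤
      3 * (3 * (𝔣.tBound * R) * 𝔣.tiBound) := by
  have h1 : ‖D.τ₁ (((γ : GL (Fin 3) D.E) : Matrix (Fin 3) (Fin 3) D.E) i j)‖ =
      ‖(𝔣.t * mat (D.ballRep 𝔣 γ) * 𝔣.ti) i j‖ := by
    rw [← D.map_τ₁_eq 𝔣 γ, Matrix.map_apply]
  rw [h1]
  exact norm_mul_apply_le (norm_mul_apply_le 𝔣.norm_t_le h) 𝔣.norm_ti_le i j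

/-- **Bounded at all embeddings**: for each `R` there is `B` such that every `γ ∈ Γ` whose image
`ballRep γ` has entries of norm `≤ R` has `‖τ(γᵢⱼ)‖ ≤ B` for EVERY complex embedding `τ` of `E`.
[cite: PlatonovRapinchuk1994, §3.2 Thm 3.1] -/
theorem exists_forall_norm_embedding_apply_le (R : ℝ) :
    ∃ B : ℝ, ∀ γ : D.Γ, (∀ i j, ‖mat (D.ballRep 𝔣 γ) i j‖ ≤ R) →
      ∀ (τ : D.E →+* ℂ) (i j : Fin 3),
        ‖τ (((γ : GL (Fin 3) D.E) : Matrix (Fin 3) (Fin 3) D.E) i j)‖ ≤ B := by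
  have hC : ∀ τ : D.E →+* ℂ, ∃ C : ℝ, InfinitePlace.mk τ ≠ InfinitePlace.mk D.τ₁ →
      ∀ γ : D.Γ, ∀ i j, ‖τ (((γ : GL (Fin 3) D.E) : Matrix (Fin 3) (Fin 3) D.E) i j)‖ ≤ C := by
    intro τ
    by_cases hτ : InfinitePlace.mk τ = InfinitePlace.mk D.τ₁
    · exact ⟨0, fun h ↦ (h hτ).elim⟩
    · obtain ⟨C, hC⟩ := D.exists_norm_embedding_apply_le τ hτ
      exact ⟨C, fun _ ↦ hC⟩
  choose C hC using hC
  refine ⟨3 * (3 * (𝔣.tBound * |R|) * 𝔣.tiBound) + ∑ τ, |C τ|, fun γ hγ τ i j ↦ ?_⟩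
  have hR : ∀ i j, ‖mat (D.ballRep 𝔣 γ) i j‖ ≤ |R| := fun i j ↦ (hγ i j).trans (le_abs_self R)
  have h0 : 0 ≤ 3 * (3 * (𝔣.tBound * |R|) * 𝔣.tiBound) :=
    (norm_nonneg _).trans (D.norm_τ₁_apply_le 𝔣 hR 0 0)
  have hsum : 0 ≤ ∑ τ', |C τ'| := Finset.sum_nonneg fun _ _ ↦ abs_nonneg _
  by_cases hτ : InfinitePlace.mk τ = InfinitePlace.mk D.τ₁
  · rw [D.norm_embedding_eq_of_mk_eq hτ]
    exact (D.norm_τ₁_apply_le 𝔣 hR i j).trans (le_add_of_nonneg_right hsum)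
  · calc ‖τ (((γ : GL (Fin 3) D.E) : Matrix (Fin 3) (Fin 3) D.E) i j)‖ ≤ C τ := hC τ hτ γ i j
      _ ≤ |C τ| := le_abs_self _
      _ ≤ ∑ τ', |C τ'| :=
          Finset.single_le_sum (f := fun τ' ↦ |C τ'|) (fun _ _ ↦ abs_nonneg _) (Finset.mem_univ τ)
      _ ≤ _ := le_add_of_nonneg_left h0

/-- **Finiteness inside `Γ(𝔫)`**: only finitely many `γ ∈ Γ ∩ Γ(𝔫)` have `ballRep γ` with
entries of norm `≤ R` (integral elements of `E` with all conjugates bounded form a finite set).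
[cite: Borel1969, §1] -/
theorem finite_setOf_mem_principal (n : ℕ) (R : ℝ) :
    {γ : D.Γ | (γ : GL (Fin 3) D.E) ∈ principalCongruenceSubgroup (conjRingHom D.E) D.H n ∧
      ∀ i j, ‖mat (D.ballRep 𝔣 γ) i j‖ ≤ R}.Finite := by
  obtain ⟨B, hB⟩ := D.exists_forall_norm_embedding_apply_le 𝔣 R
  set T : Set D.E := {x : D.E | IsIntegral ℤ x ∧ ∀ φ : D.E →+* ℂ, ‖φ x‖ ≤ B} with hT
  have hTfin : T.Finite := Embeddings.finite_of_norm_le D.E ℂ B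
  haveI : Finite T := hTfin.to_subtype
  -- every such `γ` has its matrix in the (finite) range of `(Fin 3 → Fin 3 → T) → M₃(E)`
  let F : (Fin 3 → Fin 3 → T) → Matrix (Fin 3) (Fin 3) D.E := fun f ↦ Matrix.of fun i j ↦ (f i j : D.E)
  have hrange : (Set.range F).Finite := Set.finite_range F
  let M : D.Γ → Matrix (Fin 3) (Fin 3) D.E := fun γ ↦ ((γ : GL (Fin 3) D.E) : Matrix (Fin 3) (Fin 3) D.E)
  have hMinj : Function.Injective M := fun γ γ' h ↦ Subtype.ext (Units.ext h)
  refine (hrange.preimage hMinj.injOn).subset fun γ hγ ↦ ?_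
  refine ⟨fun i j ↦ ⟨M γ i j, D.isIntegral_apply hγ.1 i j, fun φ ↦ hB γ hγ.2 φ i j⟩, ?_⟩
  ext i j
  rfl

/-- **Discreteness**: only finitely many `γ ∈ Γ` have `ballRep γ ∈ U(2,1)` with all entries of norm
`≤ R`. (Reduce to `Γ(𝔫)`, of finite index in `Γ`: write `γ = s·δ` with `s` a coset representative and
`δ ∈ Γ(𝔫)`, whose entries are then bounded too.) [cite: Borel1969, §1] -/
theorem finite_setOf_norm_entry_le (R : ℝ) :
    {γ : D.Γ | ∀ i j, ‖mat (D.ballRep 𝔣 γ) i j‖ ≤ R}.Finite := by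
  obtain ⟨n, -, hle, hfi⟩ := D.isCongruenceSubgroup.2
  set N : Subgroup D.Γ := (principalCongruenceSubgroup (conjRingHom D.E) D.H n).subgroupOf D.Γ
  haveI : N.FiniteIndex := hfi
  -- coset representatives and a common bound for their inverses
  let s : D.Γ ⧸ N → D.Γ := fun q ↦ q.out
  haveI : Fintype (D.Γ ⧸ N) := Fintype.ofFinite _
  let C : ℝ := ∑ q : D.Γ ⧸ N, ‖mat (D.ballRep 𝔣 (s q)) 2 2‖
  have hCq : ∀ q i j, ‖mat (D.ballRep 𝔣 (s q))⁻¹ i j‖ ≤ C := fun q i j ↦ by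
    calc ‖mat (D.ballRep 𝔣 (s q))⁻¹ i j‖ = ‖mat (D.ballRep 𝔣 (s q)) j i‖ := norm_mat_inv_apply _ i j
      _ ≤ ‖mat (D.ballRep 𝔣 (s q)) 2 2‖ := norm_entry_le_norm_22 _ j i
      _ ≤ C := Finset.single_le_sum (f := fun q' ↦ ‖mat (D.ballRep 𝔣 (s q')) 2 2‖)
          (fun _ _ ↦ norm_nonneg _) (Finset.mem_univ q)
  -- the finite set of pairs (coset, bounded element of `Γ(𝔫)`)
  have hfin := (Set.finite_univ (α := D.Γ ⧸ N)).prod (D.finite_setOf_mem_principal 𝔣 n (3 * (C * R)))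
  refine (hfin.image fun qδ ↦ s qδ.1 * qδ.2).subset fun γ hγ ↦ ?_
  refine ⟨((γ : D.Γ ⧸ N), (s (γ : D.Γ ⧸ N))⁻¹ * γ), ⟨Set.mem_univ _, ?_, ?_⟩, by simp⟩
  · have hmem : (s (γ : D.Γ ⧸ N))⁻¹ * γ ∈ N := by
      rw [← QuotientGroup.eq]
      exact QuotientGroup.out_eq' _
    exact Subgroup.mem_subgroupOf.1 hmem
  · intro i j
    rw [map_mul, map_inv, mat_mul]
    exact norm_mul_apply_le (hCq _) hγ i j

/-! ### Proper discontinuity and freeness -/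

/-- **Proper discontinuity**: for compact `K, L ⊆ 𝔹²`, only finitely many `γ ∈ Γ` move a point of
`K` into `L`. [cite: Borel1969, Prop. 7.13] -/
theorem finite_setOf_smul_mem {K L : Set Ball} (hK : IsCompact K) (hL : IsCompact L) :
    {γ : D.Γ | ∃ z ∈ K, D.ballRep 𝔣 γ • z ∈ L}.Finite := by
  obtain ⟨R, hR⟩ := exists_norm_entry_le_of_isCompact hK hL
  exact (D.finite_setOf_norm_entry_le 𝔣 R).subset fun γ ⟨z, hz, hγz⟩ ↦ hR _ z hz hγz

/-- The stabiliser of a ball point in `Γ`. [folklore] -/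
def ballStabilizer (z : Ball) : Subgroup D.Γ :=
  (MulAction.stabilizer U21 z).comap (D.ballRep 𝔣)

/-- Membership in the stabiliser. [folklore] -/
theorem mem_ballStabilizer_iff {z : Ball} {γ : D.Γ} :
    γ ∈ D.ballStabilizer 𝔣 z ↔ D.ballRep 𝔣 γ • z = z :=
  Iff.rfl

/-- Stabilisers are finite. [cite: Borel1969, Prop. 7.13] -/
theorem finite_ballStabilizer (z : Ball) : (D.ballStabilizer 𝔣 z : Set D.Γ).Finite :=
  (D.finite_setOf_smul_mem 𝔣 (isCompact_singleton (x := z)) isCompact_singleton).subset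
    fun γ hγ ↦ ⟨z, rfl, by rw [D.mem_ballStabilizer_iff 𝔣 |>.1 hγ]; rfl⟩

/-- **Freeness**: `Γ` (torsion free) acts freely on the ball — `γ z = z ⇒ γ = 1`.
[cite: BergeronMillsonMoeglin2016Balls, Introduction §1.1] -/
theorem eq_one_of_smul_eq {γ : D.Γ} {z : Ball} (h : D.ballRep 𝔣 γ • z = z) : γ = 1 := by
  have hΓ : IsOfFinOrder γ := by
    by_contra hnot
    have hinj : Function.Injective fun n : ℕ ↦ γ ^ n := injective_pow_iff_not_isOfFinOrder.2 hnot
    refine (Set.infinite_range_of_injective hinj).mono ?_ (D.finite_ballStabilizer 𝔣 z)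
    rintro _ ⟨n, rfl⟩
    exact (D.ballStabilizer 𝔣 z).pow_mem h n
  have hGL : IsOfFinOrder (γ : GL (Fin 3) D.E) := D.Γ.subtype.isOfFinOrder hΓ
  exact OneMemClass.coe_eq_one.1 (D.torsionFree _ γ.2 hGL)

/-- The orbit map `γ ↦ γ z` of `Γ` is injective. [folklore] -/
theorem smul_left_injective (z : Ball) : Function.Injective fun γ : D.Γ ↦ D.ballRep 𝔣 γ • z := by
  intro γ γ' h
  have h' : D.ballRep 𝔣 (γ'⁻¹ * γ) • z = z := by
    simp only at h
    rw [map_mul, map_inv, mul_smul, h, inv_smul_smul]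
  have := D.eq_one_of_smul_eq 𝔣 h'
  rw [inv_mul_eq_one] at this
  exact this.symm

/-- **Local triviality of the action**: every ball point has an open neighbourhood `U` such that
`γ U ∩ U ≠ ∅` only for `γ = 1`. [cite: Borel1969, Prop. 7.13] -/
theorem exists_isOpen_forall_smul_mem_imp (z : Ball) :
    ∃ U : Set Ball, IsOpen U ∧ z ∈ U ∧
      ∀ γ : D.Γ, ∀ w ∈ U, D.ballRep 𝔣 γ • w ∈ U → γ = 1 := by
  obtain ⟨K, hK, hKz⟩ := exists_compact_mem_nhds z
  set F : Set D.Γ := {γ | ∃ w ∈ K, D.ballRep 𝔣 γ • w ∈ K}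
  have hF : F.Finite := D.finite_setOf_smul_mem 𝔣 hK hK
  -- for each `γ ≠ 1` separate `γ z ≠ z` from `z`
  have hsep : ∀ γ : D.Γ, ∃ V : Set Ball, IsOpen V ∧ z ∈ V ∧
      (γ ≠ 1 → ∀ w ∈ V, D.ballRep 𝔣 γ • w ∉ V) := by
    intro γ
    by_cases hγ : γ = 1
    · exact ⟨Set.univ, isOpen_univ, Set.mem_univ _, fun h ↦ (h hγ).elim⟩
    · have hne : D.ballRep 𝔣 γ • z ≠ z := fun h ↦ hγ (D.eq_one_of_smul_eq 𝔣 h)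
      obtain ⟨u, v, hu, hv, hzu, hzv, huv⟩ := t2_separation hne
      refine ⟨v ∩ (fun w ↦ D.ballRep 𝔣 γ • w) ⁻¹' u,
        hv.inter (hu.preimage (continuous_const_smul _)), ⟨hzv, hzu⟩, fun _ w hw hγw ↦ ?_⟩
      exact Set.disjoint_left.1 huv hw.2 hγw.1
  choose V hVo hVz hV using hsep
  refine ⟨interior K ∩ ⋂ γ ∈ F, V γ,
    isOpen_interior.inter (hF.isOpen_biInter fun γ _ ↦ hVo γ),
    ⟨mem_interior_iff_mem_nhds.2 hKz, Set.mem_iInter₂.2 fun γ _ ↦ hVz γ⟩, fun γ w hw hγw ↦ ?_⟩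
  by_contra hγ
  have hγF : γ ∈ F := ⟨w, interior_subset hw.1, interior_subset hγw.1⟩
  exact hV γ hγ w (Set.mem_iInter₂.1 hw.2 γ hγF) (Set.mem_iInter₂.1 hγw.2 γ hγF)

/-- **Local injectivity of the uniformization**: every ball point has an open neighbourhood on
which `ballUnifMap : 𝔹² → X(ℂ)` is injective (its fibres are the `Γ`-orbits, `ballUnifMap_eq_iff`).
[cite: BergeronMillsonMoeglin2016Balls, Introduction §1.1] -/
theorem exists_isOpen_injOn_ballUnifMap (z : Ball) :
    ∃ U : Set Ball, IsOpen U ∧ z ∈ U ∧ Set.InjOn (D.ballUnifMap 𝔣) U := by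
  obtain ⟨U, hU, hzU, h⟩ := D.exists_isOpen_forall_smul_mem_imp 𝔣 z
  refine ⟨U, hU, hzU, fun w hw w' hw' heq ↦ ?_⟩
  obtain ⟨γ, hγ⟩ := (D.ballUnifMap_eq_iff 𝔣 w w').1 heq
  have h1 : γ = 1 := h γ w hw (by rw [hγ]; exact hw')
  rw [← hγ, h1, map_one, one_smul]

end UnitaryBallUniformisationDatum

end Literature.AlgebraicGeometry.ShimuraVarieties

end
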